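import Summits.BirchSwinnertonDyer.Rank1Residual.X11b.MultiplicativeSurjectivity
import Summits.BirchSwinnertonDyer.Rank1Residual.GaloisImage.PotMultLargeImage
import Summits.BirchSwinnertonDyer.Rank1Residual.AdditivePotMult.TwistSupplyJ
import Literature.NumberTheory.EllipticCurves.OpenImageMazurAssemblyProofs
import Literature.NumberTheory.EllipticCurves.ExceptionalPrimesDensityModels
import HarnessLib

/-!
# `Irr ∧ p ∤ ord_p j(E) ⟹ ρ̄_{E,p}` SURJECTIVE at a multiplicative OR potentially multiplicative odd prime — model-free `j`-form and the X4(M) twist transport (cell `b2b-bsdres`, sub-cell `multr1-p2`, gen 8)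

HONEST FRAMING (verbatim, cell `b2b-bsdres`): the goal of the cell is to DELETE the
COMBINATION-SHAPED residual classes for ALL analytic-rank `≤ 1` curves over `ℚ` — "full BSD
formula for every rank `≤ 1` curve in class `C`" assembled STRICTLY from published theorems — so
that the rank-`≤ 1` remainder becomes exactly the CONSTRUCTION-SHAPED classes, which are TYPED
(missing-input Props), NOT attempted; this is not "finishing BSD". Research route `p2` for class
X11b; service lemmas for the sister sub-cell `additive-p1` (X4(M)); no claim beyond the stated
classes; nothing booked; labels unchanged. Theorems only (no definition, no named fact).

## What this file does

`MultiplicativeSurjectivity.lean` proves `Mult ∧ Irr ∧ p ∤ ord_p Δ_min ⟹ Surj` for a GLOBALLY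
MINIMAL equation (Silverman *ATAEC* V.6.1 at `ℓ = p` + Serre Prop. 15).  Silverman's own hypothesis
is `ℓ ∤ ord_v j(E)`, a MODEL-FREE condition; here:

* `GaloisImage.surj_of_mult_of_irr_of_not_dvd_padicValRat_j` — for ANY elliptic `W/ℚ` and an odd
  multiplicative prime `p` with `E[p]` irreducible and `p ∤ ord_p j(E)`: `Surj W p` (pass to a
  global minimal model, `hasGlobalMinimalModel_rat_holds`; `ord_p Δ_min = -ord_p j` at a
  multiplicative prime, `dvd_padicValInt_minimalDiscriminantInt_iff_of_mult`).
* **`AdditivePotMult.PotMult.surj_of_irr_of_not_dvd_padicValRat_j`** — the same at an ADDITIVE,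
  POTENTIALLY MULTIPLICATIVE odd prime `p` (`PotMult W p`): a quadratic twist `E^{(d)}` is
  multiplicative at `p` (`PotMult.exists_twist_mult`, *ATAEC* V.5.3) with the same `j` and the same
  `Irr`/`Surj` (`irr_iff_of_model_twist`, `surj_iff_of_model_twist`).  So x11c's
  `PotMult.surj_of_irr_of_eleven_le` (`p ≥ 11`, BDMTV) is complemented at `p ∈ {3, 5, 7}` by the
  decidable local condition `p ∤ ord_p j(E)`; `ClassX4M.surj_of_not_dvd_padicValRat_j`,
  `ClassX4M.dvd_padicValRat_j_of_not_surj` are the class forms (the `Surj W p` binder of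
  additive-p1's X4(M) theorems is a theorem on the très-ramifié X4(M) pairs).

Nothing is booked; X4 / X4(M) / X11b stay CONSTRUCTION-SHAPED.

## References

* [SilvermanATAEC1994] J. H. Silverman, *Advanced Topics*, V.6 Prop. 6.1 (p. 410), V.5.3.
* [SerreInventiones1972] J.-P. Serre, Invent. Math. 15 (1972), §2.4 Prop. 15.
-/

noncomputable section

open scoped Classical
open WeierstrassCurve Literature.NumberTheory.EllipticCurves
  Literature.NumberTheory.EllipticCurves.Rank1Residual

namespace Summit.BirchSwinnertonDyer.Rank1Residual.GaloisImage

variable (W : WeierstrassCurve ℚ) [W.IsElliptic] (p : ℕ) [hp : Fact p.Prime]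

/-- **`Mult ∧ Irr ∧ p ∤ ord_p j(E) ⟹ Surj`, model-free** (`p` odd; Silverman *ATAEC* V.6.1 reads
`ℓ ∤ ord_v j(E)`).  Pass to a global minimal model `C • W` (`hasGlobalMinimalModel_rat_holds`),
where `p ∣ ord_p Δ_min ↔ p ∣ ord_p j` at a multiplicative prime
(`dvd_padicValInt_minimalDiscriminantInt_iff_of_mult`), and use
`surj_of_mult_of_irr_of_not_dvd`; `Mult`, `Irr`, `Surj`, `j` are model invariants.
[cite: SilvermanATAEC1994, V.6 Prop. 6.1 (p. 410)] [cite: SerreInventiones1972, §2.4 Prop. 15] -/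
theorem surj_of_mult_of_irr_of_not_dvd_padicValRat_j (hp2 : p ≠ 2) (hmult : Mult W p)
    (hirr : Irr W p) (hj : ¬ (p : ℤ) ∣ padicValRat p W.j) : Surj W p := by
  obtain ⟨C, hC⟩ := hasGlobalMinimalModel_rat_holds W
  haveI : (C • W).IsGloballyMinimal := hC
  have hmult' : Mult (C • W) p := (hasMultiplicativeReductionAtPrime_smul_iff W C p).mpr hmult
  have hirr' : Irr (C • W) p := (Mazur1978.hasIrreducibleModPGaloisRep_smul_iff W C p).mpr hirr
  have hj' : ¬ (p : ℤ) ∣ padicValRat p (C • W).j := by rwa [variableChange_j]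
  have hΔ : ¬ p ∣ padicValInt p (C • W).minimalDiscriminantInt := by
    rwa [AdditivePotMult.dvd_padicValInt_minimalDiscriminantInt_iff_of_mult (C • W) p hmult' p]
  exact (hasSurjectiveModNGaloisRep_smul_iff W C p).mp
    (surj_of_mult_of_irr_of_not_dvd (C • W) p hp2 hmult' hirr' hΔ)

/-- **Contrapositive, model-free**: at an odd multiplicative `p` with `E[p]` irreducible and `ρ̄`
not onto, `p ∣ ord_p j(E)`. [cite: SilvermanATAEC1994, V.6 Prop. 6.1 (p. 410)] -/
theorem dvd_padicValRat_j_of_mult_of_irr_of_not_surj (hp2 : p ≠ 2) (hmult : Mult W p)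
    (hirr : Irr W p) (hns : ¬ Surj W p) : (p : ℤ) ∣ padicValRat p W.j := by
  by_contra hj
  exact hns (surj_of_mult_of_irr_of_not_dvd_padicValRat_j W p hp2 hmult hirr hj)

end Summit.BirchSwinnertonDyer.Rank1Residual.GaloisImage

/-! ### Potentially multiplicative additive primes (class X4(M)) -/

namespace Summit.BirchSwinnertonDyer.Rank1Residual.AdditivePotMult

open GaloisImage Additive

variable {W : WeierstrassCurve ℚ} [W.IsElliptic] {p : ℕ} [hp : Fact p.Prime]

/-- **Potentially multiplicative odd `p`, `E[p]` irreducible, `p ∤ ord_p j(E)` ⟹ `ρ̄_{E,p}` onto.**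
A quadratic twist `E^{(d)}` is multiplicative at `p` (`PotMult.exists_twist_mult`, Silverman
*ATAEC* V.5.3) with `j(E^{(d)}) = j(E)`, `E^{(d)}[p]` irreducible (`irr_iff_of_model_twist`); it is
surjective at `p` by `surj_of_mult_of_irr_of_not_dvd_padicValRat_j` (ATAEC V.6.1 at `ℓ = p` +
Serre Prop. 15), and surjectivity is a twist invariant (`surj_iff_of_model_twist`).  No named fact;
complements x11c's `PotMult.surj_of_irr_of_eleven_le` (`p ≥ 11`) at `p ∈ {3, 5, 7}`.
[cite: SilvermanATAEC1994, V.6 Prop. 6.1 (p. 410) and V.5.3] [cite: SerreInventiones1972, §2.4 Prop. 15] -/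
theorem PotMult.surj_of_irr_of_not_dvd_padicValRat_j (hp2 : p ≠ 2) (hpm : PotMult W p)
    (hirr : Irr W p) (hj : ¬ (p : ℤ) ∣ padicValRat p W.j) : Surj W p := by
  obtain ⟨d, hd0, hmultd⟩ := hpm.exists_twist_mult
  haveI := W.isElliptic_quadraticTwist hd0
  have hWd : ∃ C : VariableChange ℚ, C • W.quadraticTwist d = W.quadraticTwist d :=
    ⟨1, one_smul _ _⟩
  have hirr' : Irr (W.quadraticTwist d) p := (irr_iff_of_model_twist (W := W) hd0 hWd).mpr hirr
  have hj' : ¬ (p : ℤ) ∣ padicValRat p (W.quadraticTwist d).j := by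
    rwa [j_of_model_twist (W := W) hd0 hWd]
  have hs' : Surj (W.quadraticTwist d) p :=
    surj_of_mult_of_irr_of_not_dvd_padicValRat_j (W.quadraticTwist d) p hp2 hmultd hirr' hj'
  exact (surj_iff_of_model_twist W p hd0 hWd).mp hs'

/-- **Contrapositive**: at a potentially multiplicative odd `p` with `E[p]` irreducible and `ρ̄`
not onto, `p ∣ ord_p j(E)`. [cite: SilvermanATAEC1994, V.6 Prop. 6.1 (p. 410) and V.5.3] -/
theorem PotMult.dvd_padicValRat_j_of_irr_of_not_surj (hp2 : p ≠ 2) (hpm : PotMult W p)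
    (hirr : Irr W p) (hns : ¬ Surj W p) : (p : ℤ) ∣ padicValRat p W.j := by
  by_contra hj
  exact hns (PotMult.surj_of_irr_of_not_dvd_padicValRat_j hp2 hpm hirr hj)

/-- **Class X4(M): `Surj` on the très-ramifié pairs** (`ClassX4M = (p ≠ 2 ∧ Addv ∧ Irr) ∧ PotMult`):
`p ∤ ord_p j(E) ⟹ Surj W p`.  Discharges the `Surj W p` binder of the sub-cell additive-p1's X4(M)
theorems on that decidable sub-population, every odd `p`; label unchanged.
[cite: SilvermanATAEC1994, V.6 Prop. 6.1 (p. 410) and V.5.3] -/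
theorem ClassX4M.surj_of_not_dvd_padicValRat_j (hX : ClassX4M W p)
    (hj : ¬ (p : ℤ) ∣ padicValRat p W.j) : Surj W p :=
  PotMult.surj_of_irr_of_not_dvd_padicValRat_j hX.1.1 (ClassX4M.potMult W p hX)
    (ClassX4M.irr W p hX) hj

/-- **Class X4(M) with `ρ̄_{E,p}` NOT onto has `p ∣ ord_p j(E)`** (and `p ∈ {5,7}` when `p ≥ 5`,
`ClassX4M.eq_five_or_eq_seven_of_not_surj`). [cite: SilvermanATAEC1994, V.6 Prop. 6.1 (p. 410) and V.5.3] -/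
theorem ClassX4M.dvd_padicValRat_j_of_not_surj (hX : ClassX4M W p) (hns : ¬ Surj W p) :
    (p : ℤ) ∣ padicValRat p W.j :=
  PotMult.dvd_padicValRat_j_of_irr_of_not_surj hX.1.1 (ClassX4M.potMult W p hX)
    (ClassX4M.irr W p hX) hns

end Summit.BirchSwinnertonDyer.Rank1Residual.AdditivePotMult

end
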